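import Summits.QuantumFields.BalabanUV.Beta.GAN24.LegPushNestAux

/-!
# `BalabanUV.Beta.GAN24.LegPushNest` — binder row G-an2-4 ∕ (CONV-C), W-slot, the (α-0) parity re-cut, located crux (Q-L-k₀) (RULING R-gan24p1-g36-1
# (5)(C): the carrier of the (Q-L-k₀) END): **THE THREE-LEG PUSH NESTS** — `legPush l₁ r₁ (legPush l₂ r₂ X) = legPush (kcomp l₂ l₁) (legComp r₂ r₁) X`
# for localised legs and a `LocStencil₂` table (leaf-17's `Push4Nest.push₄_push₄` ∕ leaf-01 g43's `Push3Nest.push₃_push₃` pattern, with `legPush`'s bond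
# SYMMETRISATION carried through — it reproduces itself), so leaf-03's k₀-fold `legChain` of `legStep`s is ONE `legPush` through the composite legs — the
# shape `LegStepPush.locStencil₂_legPush_bsum` (and the OWNER g36's block-ℓ¹ twin) consumes (part 2 of 2; part 1 = `GAN24/LegPushNestAux`).

NOT IN PRINT; OUR BOOKKEEPING ([folklore] absolutely convergent re-bracketing; 0 `def`, 0 cited facts, 0 `def … : Prop`, 0 sorry, 0 wall binders).  HONEST
FRAMING (cell contract, verbatim): «discharging `BetaPertH` makes Bałaban's UV stability UNCONDITIONAL — a real constructive-QFT result; it is NOT the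
continuum limit and NOT the Clay problem.»  HONEST DEPENDENCY (verbatim): «continuum YM on T⁴ ⇐ BetaPertH ∧ nine spine estimates (0/9 proved); BetaPertH ⇐
(D1) ∧ (D4) ∧ CAP+tail; G-an2-4 gates asym, D1 and NE2/3/4.»

## What is proved (generic `d`)
* §4 `comp_smul_right`, `summable_Kk_mul_bdd`, `exists_legDecay_legComp`, and **`legPush_legPush`** — THE NESTING LAW: for full-row kernel legs with
  `|l_i α x′ f x| ≤ Cl_i·e^{−m_i|x − N_i•x′|₁}` and slot legs `LegDecay r_i N_i Cr_i m_i` (`m_i > 0`; outer `i = 1`, inner `i = 2`) and `LocStencil₂ X C δ` (`δ > 0`):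
  `legPush l₁ r₁ (legPush l₂ r₂ X) κ u κ′ u′ = legPush (kcomp l₂ l₁) (legComp r₂ r₁) X κ u κ′ u′`.  No rate or constant enters the statement.  Route: the inner
  push is the UNSYMMETRISED push of the symmetrised table `½•(X + Xᵀ)` (part 1 `legPush_eq_comp_Kk_symT`); the outer double vertex passes the inner kernel leg
  (`vertex2W_comp_Kk`) and merges with the inner slot legs (`vertex2W_vertex2W`); the two kernel legs re-associate (`KernelWard.comp_assoc_of_bound`, dominated
  by the legs' and the composite vertex's decay) and compose (`comp_Kk_Kk`); the symmetrised table is idempotent under symmetrisation.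
Asserts NOTHING about Bałaban's tables; NOT (H1♮) (the k₀-fold iterate along leaf-03's `legChain` with `legStep_eq_smul_legPush`, the dressed legs, the
socket instantiation are the next files); discharges NOTHING of (Q-L) ∕ (C) ∕ «T2Shape» ∕ «T2Drift» ∕ (hW, hWall); NEVER «G-an2-4 closed» as (CONV-C); NOT D1,
NOT `BetaPertH`, NOT continuum, NOT Clay; not in print.
Unit `b2b-balaban-gan24-formalise-leaf-01` (G-an2-4 formalisation swarm, leaf prover 01, gen 74), 2026-08-23.
-/

noncomputable section

open Finset
open scoped BigOperators
open Literature.MathematicalPhysics.QuantumFieldTheory.Balaban1983to89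
open Literature.MathematicalPhysics.QuantumFieldTheory.Balaban1983to89.Beta
open B12Sec2to5 (l1 l1_nonneg)
open ExpKernelCalculus (MKer Decays comp Zl Zl_nonneg Zl_pos summable_exp_shift summable_exp_shift' tsum_exp_shift' l1_sub_triangle l1_sub_symm)
open OneStepResolventKernel (Fib)
open BalabanCompositeJets (LocStencil₂ LocStencil₂.nonneg summable_slice_of_locStencil₂)
open KernelWard (comp_assoc_of_bound comp_sub_right)
open Summit.QuantumFields.BalabanUV.Beta.GAN24.BiStencilZeroMode (Tab)
open Summit.QuantumFields.BalabanUV.Beta.GAN24.Push4 (legComp legComp_apply vertexW vertexW_apply vertex2W)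
open Summit.QuantumFields.BalabanUV.Beta.GAN24.Push4Bounds (LegDecay LegDecay.nonneg LegDecay.abs_le LegDecay.summable)
open Summit.QuantumFields.BalabanUV.Beta.GAN24.Push4NestTable (vertexW_vertexW vertexW_comp_left vertexW_comm vertexW_congr)
open Summit.QuantumFields.BalabanUV.Beta.GAN24.Push4NestAux (abs_vertexW_slice_le summable_vertexW_slice decays_vertex2W_of_bdd abs_le_of_decays legDecay_legComp)
open Summit.QuantumFields.BalabanUV.Beta.GAN24.LegStepPush (legPush legPush_inl legPush_inr vertex2W_entry)

open Summit.QuantumFields.BalabanUV.Beta.GAN24.LegPushNestAux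

namespace Summit.QuantumFields.BalabanUV.Beta.GAN24.LegPushNest

variable {d : ℕ}

variable {l l₁ l₂ : Fin (d + 1) → (Fin (d + 1) → ℤ) → Fib d → (Fin (d + 1) → ℤ) → ℝ}
  {r r₁ r₂ : Fin (d + 1) → (Fin (d + 1) → ℤ) → Fin (d + 1) → (Fin (d + 1) → ℤ) → ℝ}
  {N N₁ N₂ : ℕ} {Cl Cl₁ Cl₂ Cr Cr₁ Cr₂ m m₁ m₂ C δ : ℝ} {X : Tab d}

/-! ## §4 The nesting law -/

/-- [folklore] `comp A (c • K) = c • comp A K` (no summability). -/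
theorem comp_smul_right (A K : MKer (d + 1) (Fib d)) (c : ℝ) : comp A (c • K) = c • comp A K := by
  funext x z a b
  simp only [comp, Pi.smul_apply, smul_eq_mul]
  rw [← tsum_mul_left]
  refine tsum_congr fun y => ?_
  rw [Finset.mul_sum]
  exact Finset.sum_congr rfl fun f _ => by ring

/-- [folklore] A row-summable kernel leg against a bounded kernel: the composition's slices are summable. -/
theorem summable_Kk_mul_bdd (hl : ∀ α x' f, Summable fun x => l α x' f x) {P : MKer (d + 1) (Fib d)} {CP : ℝ} (hP : ∀ y z f b, |P y z f b| ≤ CP)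
    (x z : Fin (d + 1) → ℤ) (a b : Fib d) : Summable fun y => ∑ f, Kk l x y a f * P y z f b := by
  refine summable_sum fun f _ => ?_
  refine Summable.of_norm_bounded ((summable_Kk_row hl x a f).abs.mul_right CP) fun y => ?_
  rw [Real.norm_eq_abs, abs_mul]
  exact mul_le_mul_of_nonneg_left (hP y z f b) (abs_nonneg _)

/-- [folklore] The composite slot legs are localised at SOME positive rate (leaf-17's `legDecay_legComp` with a chosen common rate). -/
theorem exists_legDecay_legComp (hr₁ : LegDecay r₁ N₁ Cr₁ m₁) (hr₂ : LegDecay r₂ N₂ Cr₂ m₂) (hm₁ : 0 < m₁) (hm₂ : 0 < m₂) :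
    ∃ CR m' : ℝ, 0 < m' ∧ LegDecay (legComp r₂ r₁) (N₂ * N₁) CR m' := by
  obtain ⟨m', hm'0, hm'₂, hm'₁⟩ : ∃ m' : ℝ, 0 < m' ∧ m' ≤ m₂ ∧ m' * N₂ < m₁ := by
    refine ⟨min m₂ (m₁ / (2 * ((N₂ : ℝ) + 1))), lt_min hm₂ (by positivity), min_le_left _ _, ?_⟩
    have hN : (0 : ℝ) ≤ N₂ := Nat.cast_nonneg _
    have hpos : (0 : ℝ) < 2 * ((N₂ : ℝ) + 1) := by positivity
    have h1 : min m₂ (m₁ / (2 * ((N₂ : ℝ) + 1))) * N₂ ≤ m₁ / (2 * ((N₂ : ℝ) + 1)) * N₂ :=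
      mul_le_mul_of_nonneg_right (min_le_right _ _) hN
    have h2 : m₁ / (2 * ((N₂ : ℝ) + 1)) * N₂ < m₁ := by
      calc m₁ / (2 * ((N₂ : ℝ) + 1)) * N₂ < m₁ / (2 * ((N₂ : ℝ) + 1)) * (2 * ((N₂ : ℝ) + 1)) :=
            mul_lt_mul_of_pos_left (by linarith) (div_pos hm₁ hpos)
        _ = m₁ := div_mul_cancel₀ _ hpos.ne'
    exact h1.trans_lt h2
  exact ⟨_, m', hm'0, legDecay_legComp hr₁ hr₂ hm'0.le hm'₂ hm'₁⟩

/-- NOT IN PRINT; OUR BOOKKEEPING.  **THE THREE-LEG PUSH NESTS.**  For full-row kernel legs and slot legs localised at positive rates — the OUTER pair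
`(l₁, r₁)` at blocking `N₁`, the INNER pair `(l₂, r₂)` at blocking `N₂` — and a `LocStencil₂` table `X` at a positive rate:
`legPush l₁ r₁ (legPush l₂ r₂ X) κ u κ′ u′ = legPush (kcomp l₂ l₁) (legComp r₂ r₁) X κ u κ′ u′` — the bond symmetrisation reproduces itself (§2), the
kernel legs pass through the double vertex and compose by `kcomp` (§1, §3), the slot legs compose by `legComp` (§3).  No rate or constant enters the
statement.  With `LegStepPush.legStep_eq_smul_legPush` this makes leaf-03's k₀-fold `legChain` of `legStep`s ONE `legPush` through the composite legs. -/
theorem legPush_legPush (hl₁ : ∀ α x' f x, |l₁ α x' f x| ≤ Cl₁ * Real.exp (-m₁ * l1 (x - (N₁ : ℤ) • x')))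
    (hl₂ : ∀ α x' f x, |l₂ α x' f x| ≤ Cl₂ * Real.exp (-m₂ * l1 (x - (N₂ : ℤ) • x')))
    (hr₁ : LegDecay r₁ N₁ Cr₁ m₁) (hr₂ : LegDecay r₂ N₂ Cr₂ m₂) (hm₁ : 0 < m₁) (hm₂ : 0 < m₂) (hX : LocStencil₂ X C δ) (hδ : 0 < δ)
    (κ : Fin (d + 1)) (u : Fin (d + 1) → ℤ) (κ' : Fin (d + 1)) (u' : Fin (d + 1) → ℤ) :
    legPush l₁ r₁ (legPush l₂ r₂ X) κ u κ' u' = legPush (kcomp l₂ l₁) (legComp r₂ r₁) X κ u κ' u' := by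
  -- data
  have hC := hX.nonneg
  have hCr₁ := hr₁.nonneg
  have hCr₂ := hr₂.nonneg
  have hδ3 : 0 < δ / 3 := by positivity
  have hr₁s : ∀ μ y κ₀, Summable fun v => r₁ μ y κ₀ v := fun μ y κ₀ => hr₁.summable hm₁ μ y κ₀
  have hr₂s : ∀ μ y κ₀, Summable fun v => r₂ μ y κ₀ v := fun μ y κ₀ => hr₂.summable hm₂ μ y κ₀
  have hr₁b : ∀ μ y κ₀ v, |r₁ μ y κ₀ v| ≤ Cr₁ := fun μ y κ₀ v => hr₁.abs_le hm₁.le μ y κ₀ v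
  have hr₂b : ∀ μ y κ₀ v, |r₂ μ y κ₀ v| ≤ Cr₂ := fun μ y κ₀ v => hr₂.abs_le hm₂.le μ y κ₀ v
  have hl₁s : ∀ α x' f, Summable fun x => l₁ α x' f x := summable_of_klegDecay hl₁ hm₁
  have hl₂s : ∀ α x' f, Summable fun x => l₂ α x' f x := summable_of_klegDecay hl₂ hm₂
  have hCl₁ : 0 ≤ Cl₁ := by
    have h0 := hl₁ 0 0 (Sum.inl 0) ((N₁ : ℤ) • (0 : Fin (d + 1) → ℤ))
    rw [sub_self, show l1 (0 : Fin (d + 1) → ℤ) = 0 by simp [l1], mul_zero, Real.exp_zero, mul_one] at h0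
    exact (abs_nonneg _).trans h0
  have hCl₂ : 0 ≤ Cl₂ := by
    have h0 := hl₂ 0 0 (Sum.inl 0) ((N₂ : ℤ) • (0 : Fin (d + 1) → ℤ))
    rw [sub_self, show l1 (0 : Fin (d + 1) → ℤ) = 0 by simp [l1], mul_zero, Real.exp_zero, mul_one] at h0
    exact (abs_nonneg _).trans h0
  obtain ⟨CR, m', hm'0, hR⟩ := exists_legDecay_legComp hr₁ hr₂ hm₁ hm₂
  have hCR := hR.nonneg
  have hRs : ∀ μ y κ₀, Summable fun v => legComp r₂ r₁ μ y κ₀ v := fun μ y κ₀ => hR.summable hm'0 μ y κ₀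
  have hRb : ∀ μ y κ₀ v, |legComp r₂ r₁ μ y κ₀ v| ≤ CR := fun μ y κ₀ v => hR.abs_le hm'0.le μ y κ₀ v
  -- the symmetrised table and its class
  set Xs : Tab d := fun μ y ν y' => (1 / 2 : ℝ) • (X μ y ν y' + X ν y' μ y) with hXs_def
  have hXs : LocStencil₂ Xs C (δ / 3) := locStencil₂_symT hX hδ.le
  have hXs_sym : (fun μ y ν y' => (1 / 2 : ℝ) • (Xs μ y ν y' + Xs ν y' μ y)) = Xs := by
    funext μ y ν y' x z a b
    simp only [hXs_def, Pi.smul_apply, Pi.add_apply, smul_eq_mul]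
    ring
  -- (1) the inner push through the symmetrised table, unsymmetrised vertex
  have eY : legPush l₂ r₂ X = fun μ y ν y' => comp (Kk l₂) (vertex2W r₂ Xs μ y ν y') := by
    funext μ y ν y'
    exact legPush_eq_comp_Kk_symT hr₂s hr₂b hX hδ μ y ν y'
  -- the inner double vertex is bounded (it decays)
  have hV₂dec : ∀ s₁ s₂ s₃ s₄, Decays (vertex2W r₂ Xs s₁ s₂ s₃ s₄)
      ((d + 1 : ℕ) * (Cr₂ * ((d + 1 : ℕ) * (Cr₂ * (C * Zl (d + 1) (δ / 3)))) * Zl (d + 1) (δ / 3 / 2))) (δ / 3 / 2) :=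
    fun s₁ s₂ s₃ s₄ => decays_vertex2W_of_bdd hr₂b hCr₂ hXs hδ3 s₁ s₂ s₃ s₄
  have hV₂b : ∀ s₁ s₂ s₃ s₄ w z f b, |vertex2W r₂ Xs s₁ s₂ s₃ s₄ w z f b|
      ≤ (d + 1 : ℕ) * (Cr₂ * ((d + 1 : ℕ) * (Cr₂ * (C * Zl (d + 1) (δ / 3)))) * Zl (d + 1) (δ / 3 / 2)) :=
    fun s₁ s₂ s₃ s₄ w z f b => abs_le_of_decays (hV₂dec s₁ s₂ s₃ s₄) (by positivity) w z f b
  -- (2)+(3) the outer double vertex of the inner push: kernel leg out, slot legs merged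
  have eV : ∀ μ y ν y', vertex2W r₁ (fun s₁ s₂ s₃ s₄ => comp (Kk l₂) (vertex2W r₂ Xs s₁ s₂ s₃ s₄)) μ y ν y'
      = comp (Kk l₂) (vertex2W (legComp r₂ r₁) Xs μ y ν y') := by
    intro μ y ν y'
    rw [vertex2W_comp_Kk hr₁s hl₂s hV₂b, vertex2W_vertex2W hr₁ hr₂ hm₁ hm₂ hXs hδ3]
  -- the composite double vertex decays; the symmetrised middle kernel `M`
  have hVRdec : ∀ s₁ s₂ s₃ s₄, Decays (vertex2W (legComp r₂ r₁) Xs s₁ s₂ s₃ s₄)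
      ((d + 1 : ℕ) * (CR * ((d + 1 : ℕ) * (CR * (C * Zl (d + 1) (δ / 3)))) * Zl (d + 1) (δ / 3 / 2))) (δ / 3 / 2) :=
    fun s₁ s₂ s₃ s₄ => decays_vertex2W_of_bdd hRb hCR hXs hδ3 s₁ s₂ s₃ s₄
  set CV : ℝ := (d + 1 : ℕ) * (CR * ((d + 1 : ℕ) * (CR * (C * Zl (d + 1) (δ / 3)))) * Zl (d + 1) (δ / 3 / 2)) with hCVdef
  have hZ3 := Zl_nonneg (D := d + 1) hδ3
  have hZ6 := Zl_nonneg (D := d + 1) (half_pos hδ3)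
  have hCV : 0 ≤ CV := by rw [hCVdef]; positivity
  have hVRb : ∀ s₁ s₂ s₃ s₄ w z f b, |vertex2W (legComp r₂ r₁) Xs s₁ s₂ s₃ s₄ w z f b| ≤ CV :=
    fun s₁ s₂ s₃ s₄ w z f b => abs_le_of_decays (hVRdec s₁ s₂ s₃ s₄) (by positivity) w z f b
  set M : MKer (d + 1) (Fib d) := (1 / 2 : ℝ) • (vertex2W (legComp r₂ r₁) Xs κ u κ' u' + vertex2W (legComp r₂ r₁) Xs κ' u' κ u) with hMdef
  have hMle : ∀ z w g b, |M z w g b| ≤ CV * Real.exp (-(δ / 3 / 2) * l1 (z - w)) := by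
    intro z w g b
    rw [hMdef]
    simp only [Pi.smul_apply, Pi.add_apply, smul_eq_mul]
    rw [abs_mul, abs_of_pos (by norm_num : (0 : ℝ) < 1 / 2)]
    have h1 := hVRdec κ u κ' u' z w g b
    have h2 := hVRdec κ' u' κ u z w g b
    have h12 := (abs_add_le _ _).trans (add_le_add h1 h2)
    have : 0 ≤ CV * Real.exp (-(δ / 3 / 2) * l1 (z - w)) := by positivity
    linarith
  -- (4) assemble: LHS = comp (Kk l₁) (comp (Kk l₂) M) = comp (Kk (kcomp l₂ l₁)) M
  have eInner : (1 / 2 : ℝ) • (comp (Kk l₂) (vertex2W (legComp r₂ r₁) Xs κ u κ' u') + comp (Kk l₂) (vertex2W (legComp r₂ r₁) Xs κ' u' κ u))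
      = comp (Kk l₂) M := by
    rw [hMdef, comp_smul_right, StepJetData.comp_add_right (summable_Kk_mul_bdd hl₂s (hVRb κ u κ' u'))
      (summable_Kk_mul_bdd hl₂s (hVRb κ' u' κ u))]
  have eL : legPush l₁ r₁ (legPush l₂ r₂ X) κ u κ' u' = comp (Kk l₁) (comp (Kk l₂) M) := by
    rw [eY, legPush_eq_comp_Kk, eV, eV, eInner]
  have eAssoc : comp (Kk l₁) (comp (Kk l₂) M) = comp (comp (Kk l₁) (Kk l₂)) M := by
    refine comp_assoc_of_bound fun x w a b => ?_
    refine ⟨fun y => Cl₁ * Real.exp (-m₁ * l1 (y - (N₁ : ℤ) • x)) * Cl₂, fun z => CV * Real.exp (-(δ / 3 / 2) * l1 (z - w)),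
      ((summable_exp_shift' hm₁ ((N₁ : ℤ) • x)).mul_left Cl₁).mul_right Cl₂, ?_, fun y => by positivity, fun z => by positivity,
      fun y z f g => ?_⟩
    · have := (summable_exp_shift (half_pos hδ3) w).mul_left CV
      refine this.congr fun z => ?_
      rw [l1_sub_symm w z]
    · rw [abs_mul, abs_mul]
      have h1 := abs_Kk_le hl₁ x y a f
      have h2 : |Kk l₂ y z f g| ≤ Cl₂ := by
        refine (abs_Kk_le hl₂ y z f g).trans ?_
        have : Real.exp (-m₂ * l1 (z - (N₂ : ℤ) • y)) ≤ 1 := by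
          rw [Real.exp_le_one_iff]; nlinarith [l1_nonneg (z - (N₂ : ℤ) • y)]
        nlinarith
      have h3 := hMle z w g b
      calc |Kk l₁ x y a f| * |Kk l₂ y z f g| * |M z w g b|
          ≤ (Cl₁ * Real.exp (-m₁ * l1 (y - (N₁ : ℤ) • x))) * Cl₂ * (CV * Real.exp (-(δ / 3 / 2) * l1 (z - w))) := by
            gcongr
      _ = _ := by ring
  -- (5) the composite push through the symmetrised table is the composite push through `X`
  have eR : legPush (kcomp l₂ l₁) (legComp r₂ r₁) X κ u κ' u' = comp (Kk (kcomp l₂ l₁)) M := by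
    rw [legPush_eq_comp_Kk_symT hRs hRb hX hδ κ u κ' u']
    -- `comp (Kk ·) (vertex2W R Xs s) = comp (Kk ·) (½•(vertex2W R Xs s + vertex2W R Xs sᵀ))` via `Xs`'s symmetry
    have e5 : legPush (kcomp l₂ l₁) (legComp r₂ r₁) Xs κ u κ' u' = comp (Kk (kcomp l₂ l₁)) (vertex2W (legComp r₂ r₁) Xs κ u κ' u') := by
      rw [legPush_eq_comp_Kk_symT hRs hRb hXs hδ3 κ u κ' u', hXs_sym]
    rw [← e5, legPush_eq_comp_Kk]
  rw [eL, eAssoc, comp_Kk_Kk, eR]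

end Summit.QuantumFields.BalabanUV.Beta.GAN24.LegPushNest

end
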